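import Summits.CriticalPhenomena.PercolationContinuityZ3.Theorems.PercNearOneGluingNoHeavyQuantFarSunCfgCert
import Summits.CriticalPhenomena.PercolationContinuityZ3.Theorems.PercNearOneGluingNoHeavyLowerTailTwoCopyFibre
import Mathlib.Combinatorics.Colex
import HarnessLib

/-!
# FAR beyond trees: per-`K` configuration-level certificates for `HairyCycle.SunFAR K j` at MASK LEVEL — the bridge to fibre sums

builds on p205010 (kernel theorem, internal audit signed; external expert review pending)

Support file (`--supports stmt-CriticalPhenomena-4575`), seat `prim-cert-1` (gen 26); memo `prim-cert-1/FROM-prim-cert-1-g26-CONFIG-CERTS.md` §7.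
`TK.sunFAR_of_cfgCert` (`…QuantFarSunCfgCert`) reduces `SunFAR K j` to four finite conditions on a certificate `a_k(Q',m,m')`, `b(Q',m,m')`;
the expensive one is the configuration-level CORE INEQUALITY (`16 238 475` orbit sums at `K = 8`).  Here the certificate is given at mask level
by NATURAL-valued tables `am k q' m m'`, `bm q' m m'` (`q' < 2^K` the ghost's open-hair mask), and the core inequality is restated as the
nonnegativity of the FIBRE SUMS `TwoCopy.fib` (gen 18, `…LowerTailTwoCopyFibre`) of an explicit block pair function `TK.Gm` on masks — the form
that gen 18's Kronecker checker decides in GMP arithmetic (sequel file `…QuantFarSunCfgKron`):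
* `TK.enc` (`Q ↦ Σ_{i∈Q} 2^i`), `TK.pc`, `TK.covM`; bit lemmas (`testBit_enc`, `pc_enc_and_covM`, `enc_union`, `enc_sdiff`, `enc_lt`, …);
* `TK.Fm`, `TK.aOf`, `TK.bOf`, `TK.Fcfg_eq_Fm` — the pair function at mask level;  `TK.Gm` — the block pair function of `(l, m, u, v)`;
* `TK.sum_powerset_eq_fib` — the orbit sum over `J ⊆ T` is `TwoCopy.fib K (Gm …) (enc Z) (enc T)`;
* `TK.checkN` (normalisation, Boolean) and **`TK.sunFAR_of_fib`** — `checkN = true` and all fibre sums of all blocks `≥ 0` ⇒ `SunFAR K j`.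
No sorries; standard axioms; nothing here asserts anything about a particular certificate.  Elementary [this work].
-/

namespace Summit.CriticalPhenomena.PercolationContinuityZ3.Theorems.HairyCycle

namespace TK

open Finset
open Summit.CriticalPhenomena.PercolationContinuityZ3.Theorems.TwoCopy (fib)

variable {K : ℕ}

/-! ## Masks -/

/-- Bitmask of a finite set of naturals: `enc Q = Σ_{i ∈ Q} 2^i` (`= Finset.equivBitIndices.symm Q`). [folklore] -/
def enc (Q : Finset ℕ) : ℕ := ∑ i ∈ Q, 2 ^ i

/-- Popcount. [folklore] -/
def pc (n : ℕ) : ℕ := n.bitIndices.length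

/-- Coverage mask of the closed extent `(l, l')`: bits `k < K` with `k < l ∨ l' ≤ k`. [this work] -/
def covM (K l l' : ℕ) : ℕ := enc (cov K l l')

/-- Bits of `enc Q` are membership in `Q`. [folklore] -/
theorem testBit_enc (Q : Finset ℕ) (i : ℕ) : (enc Q).testBit i = decide (i ∈ Q) := by
  have h : i ∈ Q ↔ (enc Q).testBit i = true := by
    conv_lhs => rw [← Finset.toFinset_bitIndices_sum_two_pow Q]
    rw [List.mem_toFinset, Nat.mem_bitIndices]
    rfl
  by_cases hi : i ∈ Q
  · rw [h.1 hi, decide_eq_true hi]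
  · rw [decide_eq_false hi]
    cases h' : (enc Q).testBit i
    · rfl
    · exact absurd (h.2 h') hi

/-- A mask whose bits are membership in `S` has `bitIndices.toFinset = S`. [folklore] -/
theorem toFinset_bitIndices_eq_of {n : ℕ} {S : Finset ℕ} (h : ∀ i, n.testBit i = decide (i ∈ S)) :
    n.bitIndices.toFinset = S := by
  ext i
  rw [List.mem_toFinset, Nat.mem_bitIndices, h]
  exact decide_eq_true_iff

/-- Popcount of such a mask is `|S|`. [folklore] -/
theorem pc_eq_card_of {n : ℕ} {S : Finset ℕ} (h : ∀ i, n.testBit i = decide (i ∈ S)) : pc n = S.card := by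
  rw [← toFinset_bitIndices_eq_of h, List.toFinset_card_of_nodup Nat.bitIndices_nodup]
  rfl

/-- Bits of the coverage mask. [this work] -/
theorem testBit_covM (l l' i : ℕ) : (covM K l l').testBit i = decide (i ∈ cov K l l') :=
  testBit_enc _ _

/-- Bits of `enc Q ∧ covM`: membership in `Q ∩ cov`. [this work] -/
theorem testBit_enc_and_covM (Q : Finset ℕ) (l l' i : ℕ) :
    (enc Q &&& covM K l l').testBit i = decide (i ∈ Q ∩ cov K l l') := by
  rw [Nat.testBit_and, testBit_enc, testBit_covM]
  by_cases h1 : i ∈ Q <;> by_cases h2 : i ∈ cov K l l' <;> simp [h1, h2, mem_inter]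

/-- `pc (enc Q ∧ covM) = |Q ∩ cov|`. [this work] -/
theorem pc_enc_and_covM (Q : Finset ℕ) (l l' : ℕ) : pc (enc Q &&& covM K l l') = (Q ∩ cov K l l').card :=
  pc_eq_card_of (testBit_enc_and_covM Q l l')

/-- `enc Q < 2^K` for `Q ⊆ range K`. [folklore] -/
theorem enc_lt {Q : Finset ℕ} (hQ : Q ⊆ range K) : enc Q < 2 ^ K :=
  Nat.lt_pow_two_of_testBit _ fun i hi => by
    rw [testBit_enc]
    exact decide_eq_false fun h => absurd (mem_range.1 (hQ h)) (not_lt.2 hi)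

/-- `enc (A ∪ B) = enc A ||| enc B`. [folklore] -/
theorem enc_union (A B : Finset ℕ) : enc (A ∪ B) = enc A ||| enc B := by
  refine Nat.eq_of_testBit_eq fun i => ?_
  rw [Nat.testBit_or, testBit_enc, testBit_enc, testBit_enc]
  by_cases h1 : i ∈ A <;> by_cases h2 : i ∈ B <;> simp [h1, h2]

/-- `enc (A \ B) = enc A ^^^ enc B` for `B ⊆ A`. [folklore] -/
theorem enc_sdiff {A B : Finset ℕ} (h : B ⊆ A) : enc (A \ B) = enc A ^^^ enc B := by
  refine Nat.eq_of_testBit_eq fun i => ?_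
  rw [Nat.testBit_xor, testBit_enc, testBit_enc, testBit_enc]
  by_cases h1 : i ∈ A <;> by_cases h2 : i ∈ B
  · simp [h1, h2]
  · simp [h1, h2]
  · exact absurd (h h2) h1
  · simp [h1, h2]

/-- `enc B &&& enc A = enc B` for `B ⊆ A`. [folklore] -/
theorem enc_and_of_subset {A B : Finset ℕ} (h : B ⊆ A) : enc B &&& enc A = enc B := by
  refine Nat.eq_of_testBit_eq fun i => ?_
  rw [Nat.testBit_and, testBit_enc, testBit_enc]
  by_cases h1 : i ∈ A <;> by_cases h2 : i ∈ B
  · simp [h1, h2]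
  · simp [h2]
  · exact absurd (h h2) h1
  · simp [h2]

/-- Disjoint sets have disjoint masks. [folklore] -/
theorem enc_and_eq_zero {A B : Finset ℕ} (h : Disjoint A B) : enc A &&& enc B = 0 := by
  refine Nat.eq_of_testBit_eq fun i => ?_
  rw [Nat.testBit_and, testBit_enc, testBit_enc, Nat.zero_testBit]
  by_cases h1 : i ∈ A
  · have h2 : i ∉ B := disjoint_left.1 h h1
    simp [h2]
  · simp [h1]

/-- The set of a submask of `enc T` is a subset of `T`. [folklore] -/
theorem toFinset_bitIndices_subset {T : Finset ℕ} {jm : ℕ} (h : jm &&& enc T = jm) : jm.bitIndices.toFinset ⊆ T := by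
  intro i hi
  rw [List.mem_toFinset, Nat.mem_bitIndices] at hi
  have h2 := congrArg (fun n => n.testBit i) h
  simp only [Nat.testBit_and, hi, testBit_enc, Bool.true_and, decide_eq_true_eq] at h2
  exact h2

/-! ## The pair function at mask level -/

/-- Mask-level pair function: copy 1 has reached mask `r`, the ghost `(q', m, m')` chooses the bets `am k q' m m'`, `bm q' m m'`:
`Fm = Σ_{k<K} am_k · (𝟙[bit k of r clear] − 𝟙[pc r ≤ j]) − bm · (pc r − 2j)`. [this work] -/
def Fm (K j : ℕ) (am : ℕ → ℕ → ℕ → ℕ → ℕ) (bm : ℕ → ℕ → ℕ → ℕ) (r q' m m' : ℕ) : ℤ :=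
  (∑ k ∈ range K, (am k q' m m' : ℤ) * ((if r.testBit k then 0 else 1) - (if pc r ≤ j then 1 else 0))) -
    (bm q' m m' : ℤ) * ((pc r : ℤ) - 2 * j)

/-- The set-level multipliers `a_k(Q',m,m')` of a mask-level certificate (zero for `k ≥ K`). [this work] -/
def aOf (K : ℕ) (am : ℕ → ℕ → ℕ → ℕ → ℕ) : ℕ → Finset ℕ → ℕ → ℕ → ℤ :=
  fun k Q' m m' => if k < K then (am k (enc Q') m m' : ℤ) else 0

/-- The set-level multiplier `b(Q',m,m')` of a mask-level certificate. [this work] -/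
def bOf (bm : ℕ → ℕ → ℕ → ℕ) : Finset ℕ → ℕ → ℕ → ℤ :=
  fun Q' m m' => (bm (enc Q') m m' : ℤ)

/-- **Bridge**: the configuration-level pair function `Fcfg` of `(aOf am, bOf bm)` is `Fm` on the masks. [this work] -/
theorem Fcfg_eq_Fm (j : ℕ) (am : ℕ → ℕ → ℕ → ℕ → ℕ) (bm : ℕ → ℕ → ℕ → ℕ) (Q : Finset ℕ) (l l' : ℕ) (Q' : Finset ℕ) (m m' : ℕ) :
    Fcfg K j (aOf K am) (bOf bm) Q l l' Q' m m' = Fm K j am bm (enc Q &&& covM K l l') (enc Q') m m' := by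
  unfold Fcfg Fm aOf bOf
  rw [pc_enc_and_covM]
  congr 1
  refine sum_congr rfl fun k hk => ?_
  rw [if_pos (mem_range.1 hk)]
  congr 2
  have hb := testBit_enc_and_covM (K := K) Q l l' k
  by_cases h : k ∈ Q ∩ cov K l l'
  · rw [decide_eq_true h] at hb
    rw [if_neg (not_not.2 h), hb, if_pos rfl]
  · rw [decide_eq_false h] at hb
    rw [if_pos h, hb]
    rfl

/-- The BLOCK pair function of `(l, m, u, v)` on masks `(c₁, c₂)` (open-hair masks of the two copies): the four `Fm` terms of the two
pairings `(l,u),(m,v)` and `(l,v),(m,u)` — copy 1 pays to the ghost copy 2 and vice versa. [this work] -/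
def Gm (K j : ℕ) (am : ℕ → ℕ → ℕ → ℕ → ℕ) (bm : ℕ → ℕ → ℕ → ℕ) (l m u v : ℕ) (c1 c2 : ℕ) : ℤ :=
  Fm K j am bm (c1 &&& covM K l u) c2 m v + Fm K j am bm (c2 &&& covM K m v) c1 l u +
    (Fm K j am bm (c1 &&& covM K l v) c2 m u + Fm K j am bm (c2 &&& covM K m u) c1 l v)

/-- **The orbit sum over `J ⊆ T` is the fibre sum `TwoCopy.fib` of the block pair function at `(enc Z, enc T)`.** [this work] -/
theorem sum_powerset_eq_fib (G : ℕ → ℕ → ℤ) {Z T : Finset ℕ} (hT : T ⊆ range K) :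
    ∑ J ∈ T.powerset, G (enc (Z ∪ J)) (enc (Z ∪ (T \ J))) = fib K G (enc Z) (enc T) := by
  unfold fib
  refine sum_nbij' enc (fun jm => jm.bitIndices.toFinset) ?_ ?_ ?_ ?_ ?_
  · intro J hJ
    rw [mem_powerset] at hJ
    rw [mem_filter, mem_range]
    exact ⟨enc_lt (hJ.trans hT), enc_and_of_subset hJ⟩
  · intro jm hjm
    rw [mem_filter] at hjm
    rw [mem_powerset]
    exact toFinset_bitIndices_subset hjm.2
  · intro J _
    exact Finset.toFinset_bitIndices_sum_two_pow J
  · intro jm _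
    exact Finset.sum_toFinset_bitIndices_two_pow jm
  · intro J hJ
    rw [mem_powerset] at hJ
    rw [enc_union, enc_union, enc_sdiff hJ]

/-! ## Normalisation check and the final step -/

/-- Normalisation check: a ghost reaching at most `j` hairs bets at least `1` in total. [this work] -/
def checkN (K j : ℕ) (am : ℕ → ℕ → ℕ → ℕ → ℕ) : Bool :=
  decide (∀ m < K + 2, ∀ m' < K + 1, ∀ q' < 2 ^ K, pc (q' &&& covM K m m') ≤ j → 1 ≤ ∑ k ∈ range K, am k q' m m')

/-- **`SunFAR K j` from a mask-level certificate**: the normalisation check passes and every fibre sum of every block pair function is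
nonnegative (`K ≥ 2`). [this work] -/
theorem sunFAR_of_fib {j : ℕ} (hK : 2 ≤ K) (am : ℕ → ℕ → ℕ → ℕ → ℕ) (bm : ℕ → ℕ → ℕ → ℕ) (hN : checkN K j am = true)
    (hfib : ∀ l m u v : ℕ, m ≤ l → l ≤ K + 1 → u ≤ v → v ≤ K →
      ∀ z t : ℕ, z < 2 ^ K → t < 2 ^ K → z &&& t = 0 → 0 ≤ fib K (Gm K j am bm l m u v) z t) :
    SunFAR K j := by
  unfold checkN at hN
  rw [decide_eq_true_eq] at hN
  refine sunFAR_of_cfgCert hK (a := aOf K am) (b := bOf bm) ?_ ?_ ?_ ?_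
  · intro k Q' _ m _ m' _
    unfold aOf
    split
    · exact Int.natCast_nonneg _
    · exact le_rfl
  · intro Q' _ m _ m' _
    exact Int.natCast_nonneg _
  · intro Q' hQ' m hm m' hm' hcard
    rw [← pc_enc_and_covM] at hcard
    have h1 := hN m (by omega) m' (by omega) _ (enc_lt hQ') hcard
    have h2 : ((1 : ℕ) : ℤ) ≤ ((∑ k ∈ range K, am k (enc Q') m m' : ℕ) : ℤ) := by exact_mod_cast h1
    rw [Nat.cast_one, Nat.cast_sum] at h2
    refine h2.trans (le_of_eq (sum_congr rfl fun k hk => ?_))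
    unfold aOf
    rw [if_pos (mem_range.1 hk)]
  · intro l m u v hml hl huv hv Z T hZ hT hZT
    rw [← sum_add_distrib]
    have h0 := hfib l m u v hml hl huv hv (enc Z) (enc T) (enc_lt hZ) (enc_lt hT) (enc_and_eq_zero hZT)
    rw [← sum_powerset_eq_fib (Gm K j am bm l m u v) hT] at h0
    refine le_of_le_of_eq h0 (sum_congr rfl fun J _ => ?_)
    unfold Wcfg Gm
    rw [Fcfg_eq_Fm, Fcfg_eq_Fm, Fcfg_eq_Fm, Fcfg_eq_Fm]

end TK

end Summit.CriticalPhenomena.PercolationContinuityZ3.Theorems.HairyCycle
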